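import Summits.RiemannHypothesis.RiemannHypothesis.Theorems.PfPersistenceEdgeLawLayerEnergy
import HarnessLib

/-!
# Log-Pohozaev from layer regularity (RH-free helper)

Mechanism / rigidity campaign `pub-rhpf` (theory seat 2, gen 4); **no RH claims** — nothing here
touches `RiemannHypothesis`, `WindowPositivity` or the parity crux.

The typed log-Pohozaev hypothesis of theory-1 (`PfPersistence.WeilLogPohozaevAt a`: every ground
state of the window `a` with dilation virial `V` and edge intensity `I` has `V = 2c₀·a·I`,
`2c₀ = 1`) is reduced to LAYER REGULARITY of the ground states, by a different bookkeeping from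
theory-1's Hadamard/strip-Schur derivation: the MONOPOLE ENERGY OF THE DILATION DEFECT.

* `PfPersistenceEdgeLawDefect`: `V = lim D_a(w_η)/η`, `w_η = ũ_η − ũ` (dilation-defect identity).
* Split `w_η = t_η − σ_{h(η)}`: `σ_h = weilEdgeLayer a u h` the two edge layers of depth
  `h(η) = layerDepth a η = aη/(1+η)` (where `w_η = −ũ`), `t_η = weilInteriorDefect a u η` the rest.
* `PfPersistenceEdgeLawLayer`: `D_a(σ_h) = log(1/h)‖σ_h‖² + L_a(u,h) + O(‖σ_h‖²)`, so
  (`tendsto_windowDefectForm_weilEdgeLayer_div`) `D_a(σ_h)/h → I` from the edge intensity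
  (`log(1/h)‖σ_h‖²/h → I`, hence `‖σ_h‖²/h → 0`) and `L_a(u,h)/h → 0`.
* Polarisation `D(w) = D(t) − 2D(t,σ) + D(σ)` and Cauchy–Schwarz `D(t,σ)² ≤ D(t)D(σ)`: if
  `D_a(t_η)/η → 0` then `V = lim D_a(σ_{h(η)})/η = a·I = 2c₀·a·I` (`virial_eq_of_layerRegular`).

The finite energy of the layers is a THEOREM (`PfPersistenceEdgeLawLayerEnergy`, from the tree's
sup bound of ground states). So `WeilLogPohozaevAt a` follows from `LayerRegularAt a`
(`weilLogPohozaevAt_of_layerRegular`): negligible sub-layer-scale energy `L_a(u,h) = o(h)` and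
negligible interior defect `D_a(t_η) = o(η)`. In the cusp model `‖ũ‖² ≈ τ²/log(1/(a−|x|))` both
hold (`L_a = O(h/log(1/h))`, `D_a(t_η) = O(η/log²(1/η))`): what remains of R6 is exactly this layer
regularity of the true ground states — two one-sided edge asymptotics of `u`, no arithmetic input.

Reference: [Bombieri2000Weil] E. Bombieri, Rend. Mat. Acc. Lincei (9) 11 (2000) 183–233, §4, §6.
-/

set_option linter.dupNamespace false

noncomputable section

open MeasureTheory Set Filter
open scoped Topology ComplexConjugate

namespace Summit.RiemannHypothesis.RiemannHypothesis.Theorems.PfPersistence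

open Literature.NumberTheory.LFunctions
open Summit.RiemannHypothesis.RiemannHypothesis.Theorems.EvenWinsBeyondArch

variable {a : ℝ} {u v : ℝ → ℂ}

/-! ## The strip limit `D_a(σ_h)/h → I` -/

/-- An edge intensity forces `edgeMass v a r / r → 0` (`log(1/r) → ∞`). [folklore] -/
theorem tendsto_edgeMass_div {I : ℝ} (hI : HasEdgeIntensity v a I) :
    Tendsto (fun r ↦ edgeMass v a r / r) (𝓝[>] 0) (𝓝 0) := by
  have hlog : Tendsto (fun r : ℝ ↦ Real.log (1 / r)) (𝓝[>] 0) atTop := by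
    refine (tendsto_neg_atBot_atTop.comp Real.tendsto_log_nhdsGT_zero).congr fun r ↦ ?_
    rw [Function.comp_apply, one_div, Real.log_inv]
  have hinv : Tendsto (fun r : ℝ ↦ (Real.log (1 / r))⁻¹) (𝓝[>] 0) (𝓝 0) :=
    tendsto_inv_atTop_zero.comp hlog
  have hprod := hI.mul hinv
  rw [mul_zero] at hprod
  refine hprod.congr' ?_
  filter_upwards [Ioo_mem_nhdsGT (zero_lt_one' ℝ)] with r hr
  have hl : Real.log (1 / r) ≠ 0 := (Real.log_pos (one_lt_one_div hr.1 hr.2)).ne'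
  have hr0 : r ≠ 0 := hr.1.ne'
  field_simp

/-- **The strip limit.** For a ground state with edge intensity `I`, eventually-finite layer energy
and negligible sub-layer-scale energy `L_a(u,h)/h → 0`: `D_a(σ_h)/h → I`.
[cite: Bombieri2000Weil, §4 Thm 3, §6] -/
theorem tendsto_windowDefectForm_weilEdgeLayer_div (hu : IsWeilGroundState a u) {I : ℝ}
    (hI : HasEdgeIntensity u a I)
    (hfin : ∀ᶠ h in 𝓝[>] 0,
      IntegrableOn (fun t ↦ weilArchDensity t * weilIncrement (weilEdgeLayer a u h) t) (Ioi 0))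
    (hloc : Tendsto (fun h ↦ edgeLayerLocalEnergy a u h / h) (𝓝[>] 0) (𝓝 0)) :
    Tendsto (fun h ↦ windowDefectForm a (weilEdgeLayer a u h) / h) (𝓝[>] 0) (𝓝 I) := by
  have hI' := hasEdgeIntensity_weilTrunc hu hI
  have hA : Tendsto (fun h ↦ Real.log (1 / h) / h * edgeMass (weilTrunc a u) a h +
      edgeLayerLocalEnergy a u h / h) (𝓝[>] 0) (𝓝 (I + 0)) := hI'.add hloc
  have hK : Tendsto (fun h ↦ layerConstant a * (edgeMass (weilTrunc a u) a h / h))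
      (𝓝[>] 0) (𝓝 0) := by
    simpa using (tendsto_edgeMass_div hI').const_mul (layerConstant a)
  have hR : Tendsto (fun h ↦ windowDefectForm a (weilEdgeLayer a u h) / h -
      (Real.log (1 / h) / h * edgeMass (weilTrunc a u) a h + edgeLayerLocalEnergy a u h / h))
      (𝓝[>] 0) (𝓝 0) := by
    refine squeeze_zero_norm' ?_ hK
    filter_upwards [hfin, Ioc_mem_nhdsGT (half_pos (lt_min hu.pos one_pos))] with h hfinh hh
    have hest := windowDefectForm_weilEdgeLayer_estimate hu hh.1 hh.2 hfinh
    have e : windowDefectForm a (weilEdgeLayer a u h) / h -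
        (Real.log (1 / h) / h * edgeMass (weilTrunc a u) a h + edgeLayerLocalEnergy a u h / h) =
        (windowDefectForm a (weilEdgeLayer a u h) -
          (Real.log (1 / h) * edgeMass (weilTrunc a u) a h + edgeLayerLocalEnergy a u h)) / h := by
      ring
    rw [Real.norm_eq_abs, e, abs_div, abs_of_pos hh.1, ← mul_div_assoc]
    exact div_le_div_of_nonneg_right hest hh.1.le
  have hsum := hA.add hR
  rw [add_zero, add_zero] at hsum
  refine hsum.congr fun h ↦ ?_
  ring

/-! ## The layers of the dilation defect -/

/-- The **layer depth** of the dilation `η`: `h(η) = a − a/(1+η) = aη/(1+η)`. [folklore] -/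
def layerDepth (a η : ℝ) : ℝ := a * η / (1 + η)

/-- `h(η) > 0` for `a, η > 0`. [folklore] -/
theorem layerDepth_pos (ha : 0 < a) {η : ℝ} (hη : 0 < η) : 0 < layerDepth a η :=
  div_pos (mul_pos ha hη) (by linarith)

/-- `h(η) → 0⁺` as `η → 0⁺`. [folklore] -/
theorem tendsto_layerDepth (ha : 0 < a) : Tendsto (layerDepth a) (𝓝[>] 0) (𝓝[>] 0) := by
  refine tendsto_nhdsWithin_iff.2 ⟨?_, ?_⟩
  · have hc : Tendsto (fun η : ℝ ↦ a * η / (1 + η)) (𝓝 0) (𝓝 (a * 0 / (1 + 0))) :=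
      ((tendsto_const_nhds.mul tendsto_id).div (tendsto_const_nhds.add tendsto_id) (by norm_num))
    rw [mul_zero, zero_div] at hc
    exact hc.mono_left nhdsWithin_le_nhds
  · filter_upwards [self_mem_nhdsWithin] with η hη
    exact layerDepth_pos ha hη

/-- `h(η)/η → a` as `η → 0⁺`. [folklore] -/
theorem tendsto_layerDepth_div (a : ℝ) :
    Tendsto (fun η ↦ layerDepth a η / η) (𝓝[>] 0) (𝓝 a) := by
  have hc : Tendsto (fun η : ℝ ↦ a / (1 + η)) (𝓝 0) (𝓝 (a / (1 + 0))) :=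
    tendsto_const_nhds.div (tendsto_const_nhds.add tendsto_id) (by norm_num)
  rw [add_zero, div_one] at hc
  refine (hc.mono_left nhdsWithin_le_nhds).congr' ?_
  filter_upwards [self_mem_nhdsWithin] with η hη
  have hη0 : η ≠ 0 := ne_of_gt hη
  unfold layerDepth
  field_simp

/-- The **interior defect** `t_η := w_η + σ_{h(η)}`: the dilation defect with its edge layers
removed (`= (ũ_η − ũ)·1_{|x| < a/(1+η)}` up to the null set `|x| = a/(1+η)`). [folklore] -/
def weilInteriorDefect (a : ℝ) (u : ℝ → ℂ) (η : ℝ) : ℝ → ℂ :=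
  weilDilationDefect a u η + weilEdgeLayer a u (layerDepth a η)

/-- `w_η = t_η + (−1)•σ_{h(η)}`. [folklore] -/
theorem weilDilationDefect_eq_interior_add_smul (η : ℝ) :
    weilDilationDefect a u η =
      weilInteriorDefect a u η + (-1 : ℝ) • weilEdgeLayer a u (layerDepth a η) := by
  funext x
  show weilDilationDefect a u η x = (weilDilationDefect a u η + weilEdgeLayer a u (layerDepth a η)) x
    + ((-1 : ℝ) • weilEdgeLayer a u (layerDepth a η)) x
  rw [Pi.add_apply, Pi.smul_apply, neg_one_smul]
  ring

/-! ## The log-Pohozaev identity from layer regularity -/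

/-- **VIRIAL = a × EDGE INTENSITY from layer regularity.** Let `u` be a ground state of the window
`a` with dilation virial `V` (`HasDerivAt (weilDilationProfile a u) V 0`) and edge intensity `I`.
If the edge layers `σ_h` have (eventually) finite energy, the sub-layer-scale energy is negligible
(`L_a(u,h)/h → 0`) and the interior defect is negligible (`D_a(t_η)/η → 0`), then
`V = 2c₀ · a · I` (`2c₀ = 2 · edgeLawKernelConstant = 1`). Proof: `V = lim D_a(w_η)/η`
(defect identity), `w = t − σ`, `D(w) = D(t) − 2D(t,σ) + D(σ)` with `D(t,σ)² ≤ D(t)D(σ)`, and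
`D_a(σ_{h(η)})/η → a·I` (strip limit, `h(η)/η → a`). [cite: Bombieri2000Weil, §4 Thm 3, §6] -/
theorem virial_eq_of_layerRegular (hu : IsWeilGroundState a u) {V I : ℝ}
    (hV : HasDerivAt (weilDilationProfile a u) V 0) (hI : HasEdgeIntensity u a I)
    (hfin : ∀ᶠ h in 𝓝[>] 0,
      IntegrableOn (fun t ↦ weilArchDensity t * weilIncrement (weilEdgeLayer a u h) t) (Ioi 0))
    (hloc : Tendsto (fun h ↦ edgeLayerLocalEnergy a u h / h) (𝓝[>] 0) (𝓝 0))
    (htail : Tendsto (fun η ↦ windowDefectForm a (weilInteriorDefect a u η) / η)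
      (𝓝[>] 0) (𝓝 0)) :
    V = 2 * edgeLawKernelConstant * a * I := by
  have ha : 0 < a := hu.pos
  -- (1) the virial is the defect rate
  have h1 := tendsto_windowDefectForm_weilDilationDefect_div hu hV
  -- (2) the strip, read in `η`
  have hdepth := tendsto_layerDepth ha
  have h2 : Tendsto (fun η ↦ windowDefectForm a (weilEdgeLayer a u (layerDepth a η)) / η)
      (𝓝[>] 0) (𝓝 (a * I)) := by
    have h2a := (tendsto_windowDefectForm_weilEdgeLayer_div hu hI hfin hloc).comp hdepth
    have := h2a.mul (tendsto_layerDepth_div a)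
    rw [mul_comm I a] at this
    refine this.congr' ?_
    filter_upwards [self_mem_nhdsWithin] with η hη
    have hd : layerDepth a η ≠ 0 := (layerDepth_pos ha hη).ne'
    rw [Function.comp_apply]
    field_simp
  -- (3) polarisation and Cauchy–Schwarz, eventually
  have hev : ∀ᶠ η in 𝓝[>] 0,
      windowDefectForm a (weilDilationDefect a u η) =
        windowDefectForm a (weilInteriorDefect a u η) +
          2 * (-1) * windowDefectForm₂ a (weilInteriorDefect a u η)
            (weilEdgeLayer a u (layerDepth a η)) +
          (-1) ^ 2 * windowDefectForm a (weilEdgeLayer a u (layerDepth a η)) ∧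
      windowDefectForm₂ a (weilInteriorDefect a u η) (weilEdgeLayer a u (layerDepth a η)) ^ 2 ≤
        windowDefectForm a (weilInteriorDefect a u η) *
          windowDefectForm a (weilEdgeLayer a u (layerDepth a η)) := by
    filter_upwards [hdepth.eventually hfin, Ioc_mem_nhdsGT zero_lt_one] with η hfinη hη
    have hσ2 := memLp_weilEdgeLayer hu (layerDepth a η)
    have hσs : ∀ x, a ≤ |x| → weilEdgeLayer a u (layerDepth a η) x = 0 := fun _ hx ↦
      weilEdgeLayer_eq_zero_of_le_abs _ hx
    have hw2 : MemLp (weilDilationDefect a u η) 2 :=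
      memLp_weilDilationDefect hu.memLp (by linarith [hη.1])
    have hws : ∀ x, a ≤ |x| → weilDilationDefect a u η x = 0 := fun _ hx ↦
      weilDilationDefect_eq_zero ha.le hη.1.le hx
    have hwE := integrableOn_arch_weilDilationDefect hu hη.1.le hη.2
    have ht2 : MemLp (weilInteriorDefect a u η) 2 := hw2.add hσ2
    have hts : ∀ x, a ≤ |x| → weilInteriorDefect a u η x = 0 := fun x hx ↦ by
      rw [weilInteriorDefect, Pi.add_apply, hws x hx, hσs x hx, add_zero]
    have htE : IntegrableOn (fun t ↦ weilArchDensity t *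
        weilIncrement (weilInteriorDefect a u η) t) (Ioi 0) :=
      dt_finiteEnergy_add hw2 hσ2 hwE hfinη
    refine ⟨?_, windowDefectForm₂_sq_le ha ht2 hσ2 hts hσs htE hfinη⟩
    rw [← windowDefectForm_add_smul ht2 hσ2 hts hσs htE hfinη (-1),
      ← weilDilationDefect_eq_interior_add_smul]
  -- (4) the cross term is negligible
  have h4 : Tendsto (fun η ↦ windowDefectForm₂ a (weilInteriorDefect a u η)
      (weilEdgeLayer a u (layerDepth a η)) / η) (𝓝[>] 0) (𝓝 0) := by
    have hsq : Tendsto (fun η ↦ (windowDefectForm₂ a (weilInteriorDefect a u η)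
        (weilEdgeLayer a u (layerDepth a η)) / η) ^ 2) (𝓝[>] 0) (𝓝 0) := by
      have hprod := htail.mul h2
      rw [zero_mul] at hprod
      refine squeeze_zero' (Eventually.of_forall fun η ↦ sq_nonneg _) ?_ hprod
      filter_upwards [hev] with η hη
      rw [div_pow, div_mul_div_comm, ← pow_two]
      exact div_le_div_of_nonneg_right hη.2 (sq_nonneg η)
    have habs := hsq.sqrt
    rw [Real.sqrt_zero] at habs
    refine tendsto_zero_iff_norm_tendsto_zero.2 (habs.congr fun η ↦ ?_)
    rw [Real.sqrt_sq_eq_abs, Real.norm_eq_abs]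
  -- (5) assemble and compare the two limits of `D_a(w_η)/η`
  have h5 : Tendsto (fun η ↦ windowDefectForm a (weilDilationDefect a u η) / η) (𝓝[>] 0)
      (𝓝 (0 + 2 * (-1) * 0 + (-1) ^ 2 * (a * I))) := by
    refine ((htail.add (h4.const_mul (2 * (-1)))).add (h2.const_mul ((-1) ^ 2))).congr' ?_
    filter_upwards [hev] with η hη
    rw [hη.1]
    ring
  have hlim := tendsto_nhds_unique h1 h5
  rw [hlim, edgeLawKernelConstant]
  ring

/-- **Layer regularity of the window `a`**: every ground state has negligible sub-layer-scale
layer energy `L_a(u,h) = o(h)` (`h → 0⁺`) and negligible interior dilation defect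
`D_a(t_η) = o(η)` (`η → 0⁺`). The residue of theory-1's R6 after this reduction; TRUE in the cusp
model (rates `1/log(1/h)`, `1/log²(1/η)`), NOT proved for the true ground states: a DEFINITION used
only as an explicit hypothesis — posited, not a fact (campaign label DERIVED). [folklore] -/
def LayerRegularAt (a : ℝ) : Prop :=
  ∀ u : ℝ → ℂ, IsWeilGroundState a u →
    Tendsto (fun h ↦ edgeLayerLocalEnergy a u h / h) (𝓝[>] 0) (𝓝 0) ∧
    Tendsto (fun η ↦ windowDefectForm a (weilInteriorDefect a u η) / η) (𝓝[>] 0) (𝓝 0)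

/-- **Log-Pohozaev from layer regularity**: `LayerRegularAt a → WeilLogPohozaevAt a` (the finite
energy of the layers is `eventually_integrableOn_arch_weilEdgeLayer`).
[cite: Bombieri2000Weil, §4 Thm 3, §6] -/
theorem weilLogPohozaevAt_of_layerRegular (h : LayerRegularAt a) : WeilLogPohozaevAt a :=
  fun u _ _ hu hV hI ↦ by
    obtain ⟨h2, h3⟩ := h u hu
    exact virial_eq_of_layerRegular hu hV hI (eventually_integrableOn_arch_weilEdgeLayer hu) h2 h3

/-- With layer regularity the edge intensity of a ground state is non-negative… trivially, and the
VIRIAL VANISHES IFF THE EDGE INTENSITY DOES: `V = 0 ↔ I = 0`. [folklore] -/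
theorem virial_eq_zero_iff_of_layerRegular (h : LayerRegularAt a) (hu : IsWeilGroundState a u)
    {V I : ℝ} (hV : HasDerivAt (weilDilationProfile a u) V 0) (hI : HasEdgeIntensity u a I) :
    V = 0 ↔ I = 0 := by
  have ha : 0 < a := hu.pos
  rw [weilLogPohozaevAt_of_layerRegular h u V I hu hV hI, edgeLawKernelConstant]
  constructor
  · intro h0
    have : a * I = 0 := by linarith
    exact (mul_eq_zero.1 this).resolve_left ha.ne'
  · intro h0
    rw [h0, mul_zero]

end Summit.RiemannHypothesis.RiemannHypothesis.Theorems.PfPersistence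

end
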